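import Literature.Geometry.Kaehler.ComplexTorusSubtorusQuotientCohomology
import Literature.Geometry.Kaehler.ComplexTorusHodgeStructurePolarization
import Literature.AlgebraicGeometry.Motives.HodgeStructureQuotient
import HarnessLib

/-!
# Hodge classes of an abelian subvariety lift: `ι_Y^*(Hdgᵖ(X)) = Hdgᵖ(Y)` for an abelian variety `X`

Layer `Literature/Geometry/Kaehler`, namespace `Literature.Geometry.Kaehler.ComplexTorus`; lane
`lit-hodgefound` (Track 2 foundations library, Layer A4 "Hodge classes"); THEOREMS ONLY (no definition, no
named fact). For a complex subtorus `Y ⊂ X` (rows A1-19 / Q247: `ι_Y^* = restrictForms`, a SURJECTIVE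
morphism of `ℚ`-Hodge structures `Hᵏ(X, ℚ) → Hᵏ(Y, ℚ)`, `restrictHom`, `restrictHom_surjective`) the
restriction maps Hodge classes to Hodge classes; when `X` is an abelian variety (a Riemann form exists,
`IsAbelianVariety Φ`, so that every `Hᵏ(X, ℚ)` is polarisable, `isPolarizable_hodgeStructure_of_isAbelianVariety`)
it maps them ONTO the Hodge classes of `Y`: every Hodge class of the abelian subvariety `Y` is the restriction
of a Hodge class of `X`.

Sources, VERBATIM:

* C. Voisin, *Hodge and generalized Hodge conjectures, coniveau and algebraic cycles* (2025), Cor. 2.12 (the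
  tree's `Literature.AlgebraicGeometry.Motives.HodgeStructure.Hom.map_hodgeClasses_eq_of_surjective`): for a
  morphism `φ : H′ → H` of Hodge structures of weight `2p` with `H′` polarisable and `φ` surjective,
  `φ(Hdgᵖ(H′)) = Hdgᵖ(H)` ("`ker φ` is a sub-Hodge structure, so by Prop. 2.11 `V′ = ker φ ⊕ K` with `K` a
  sub-Hodge structure and `φ|_K` injective …").
* C. Voisin, *Hodge Theory and Complex Algebraic Geometry I* (2002), §7.3.1 Def. 7.22 (morphisms of Hodge
  structures), Lemma 7.26 (sub-structures of polarised structures are polarised and split off), §7.3.2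
  (PDF pp. 148–150: `ι_Y^*`, `p^*` are morphisms of Hodge structures).

## Contents (theorems only)

* `map_restrictForms_hodgeClasses_le` — any complex torus: `ι_Y^*(Hdgᵖ(X)) ⊆ Hdgᵖ(Y)`;
* **`map_restrictForms_hodgeClasses_eq`** — `X` an abelian variety: `ι_Y^*(Hdgᵖ(X)) = Hdgᵖ(Y)`;
* `exists_mem_hodgeClasses_restrictForms_eq` — elementwise: every `δ ∈ Hdgᵖ(Y)` is `ι_Y^*γ` for some
  `γ ∈ Hdgᵖ(X)`;
* `finrank_hodgeClasses_subtorus_le` — hence `dim Hdgᵖ(Y) ≤ dim Hdgᵖ(X)` for an abelian subvariety.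

The companion statements for the projection `p : X → X/Y` (`p^*β ∈ Hdgᵖ(X) ⟺ β ∈ Hdgᵖ(X/Y)`, valid for
every complex torus since `p^*` is injective) are in `ComplexTorusSubtorusQuotientCohomologySplitting.lean` §5.

## References

* [Voisin2025] C. Voisin, *Hodge and generalized Hodge conjectures, coniveau and algebraic cycles* (2025),
  Prop. 2.11, Cor. 2.12.
* [VoisinHodgeI2002] C. Voisin, *Hodge Theory and Complex Algebraic Geometry I*, CUP (2002), §7.3.1
  Def. 7.22, Lemma 7.26; §7.3.2 (PDF pp. 148–150).
-/

noncomputable section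

-- Nested instance problems on the carriers `↥(rationalForms Φ k)` (cf. `ComplexTorusSubtorusRestrictionKernel`).
set_option maxSynthPendingDepth 3

open Module Function
open Literature.AlgebraicGeometry.Motives

namespace Literature.Geometry.Kaehler

namespace ComplexTorus

variable {ι : Type*} [Fintype ι] {E : Type*} [NormedAddCommGroup E] [NormedSpace ℂ E]
  (Φ : (ι → ℝ) ≃L[ℝ] E) (W : Submodule ℝ (ι → ℝ)) (hW : IsLatticeSubspace W) (hWc : IsComplexSubspace Φ W)

/-- **`ι_Y^*` maps Hodge classes into Hodge classes**: `ι_Y^*(Hdgᵖ(X)) ⊆ Hdgᵖ(Y)` for every complex subtorus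
`Y ⊂ X` of every complex torus (`ι_Y^*` is a morphism of Hodge structures).
[cite: VoisinHodgeI2002, §7.3.1 Def. 7.22 and §7.3.2 (PDF pp. 148–150)] -/
theorem map_restrictForms_hodgeClasses_le (p : ℕ) :
    ((hodgeStructure Φ (2 * p)).hodgeClasses p).map (restrictForms Φ W hW hWc (2 * p)) ≤
      (hodgeStructure (subtorusPeriod Φ W hW hWc) (2 * p)).hodgeClasses p :=
  (restrictHom Φ W hW hWc (2 * p)).map_hodgeClasses_le p

/-- **Hodge classes of an abelian subvariety lift to the ambient abelian variety**:
`ι_Y^*(Hdgᵖ(X)) = Hdgᵖ(Y)` when `X` is an abelian variety (Voisin 2025, Cor. 2.12, applied to the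
surjective morphism `ι_Y^* : H^{2p}(X, ℚ) → H^{2p}(Y, ℚ)` of Hodge structures, `H^{2p}(X, ℚ)` being
polarisable). [cite: Voisin2025, Cor. 2.12] [cite: VoisinHodgeI2002, §7.3.1 Lemma 7.26 and §7.3.2 (PDF pp. 148–150)] -/
theorem map_restrictForms_hodgeClasses_eq [DecidableEq ι] (hX : IsAbelianVariety Φ) (p : ℕ) :
    ((hodgeStructure Φ (2 * p)).hodgeClasses p).map (restrictForms Φ W hW hWc (2 * p)) =
      (hodgeStructure (subtorusPeriod Φ W hW hWc) (2 * p)).hodgeClasses p := by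
  haveI := finiteDimensional_rationalForms Φ (2 * p)
  haveI : FiniteDimensional ℝ E := LinearEquiv.finiteDimensional Φ.toLinearEquiv
  haveI : FiniteDimensional ℂ E := Module.Finite.of_restrictScalars_finite ℝ ℂ E
  exact (restrictHom Φ W hW hWc (2 * p)).map_hodgeClasses_eq_of_surjective (restrictHom_surjective Φ W hW hWc _)
    (isPolarizable_hodgeStructure_of_isAbelianVariety Φ hX (2 * p)) (by push_cast; ring)

/-- Elementwise: **every Hodge class of the abelian subvariety `Y` is the restriction of a Hodge class of
`X`** (`X` an abelian variety). [cite: Voisin2025, Cor. 2.12] -/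
theorem exists_mem_hodgeClasses_restrictForms_eq [DecidableEq ι] (hX : IsAbelianVariety Φ) {p : ℕ}
    {δ : rationalForms (subtorusPeriod Φ W hW hWc) (2 * p)}
    (hδ : δ ∈ (hodgeStructure (subtorusPeriod Φ W hW hWc) (2 * p)).hodgeClasses p) :
    ∃ γ ∈ (hodgeStructure Φ (2 * p)).hodgeClasses p, restrictForms Φ W hW hWc (2 * p) γ = δ := by
  rw [← map_restrictForms_hodgeClasses_eq Φ W hW hWc hX p] at hδ
  obtain ⟨γ, hγ, rfl⟩ := hδ
  exact ⟨γ, hγ, rfl⟩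

/-- **`dim Hdgᵖ(Y) ≤ dim Hdgᵖ(X)`** for an abelian subvariety `Y` of an abelian variety `X` (the restriction
is onto on Hodge classes). [cite: Voisin2025, Cor. 2.12] -/
theorem finrank_hodgeClasses_subtorus_le [DecidableEq ι] (hX : IsAbelianVariety Φ) (p : ℕ) :
    finrank ℚ ((hodgeStructure (subtorusPeriod Φ W hW hWc) (2 * p)).hodgeClasses p) ≤
      finrank ℚ ((hodgeStructure Φ (2 * p)).hodgeClasses p) := by
  haveI := finiteDimensional_rationalForms Φ (2 * p)
  rw [← map_restrictForms_hodgeClasses_eq Φ W hW hWc hX p]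
  exact Submodule.finrank_map_le _ _

end ComplexTorus

end Literature.Geometry.Kaehler
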